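import Literature.MathematicalPhysics.QuantumFieldTheory.BalabanImbrieJaffe1984to88.BIJ88SlotConnectedGraph310KP

/-!
# `BalabanImbrieJaffe1984to88.BIJ88SlotCumulants308` — T. Bałaban, J. Imbrie, A. Jaffe, *Effective action and cluster properties of the abelian
Higgs model*, Commun. Math. Phys. **114** (1988) 257–315 [BalabanImbrieJaffe1988], Sect. 5.14 pp. 308–310 [PDF 52–54]: **the truncated
expectations `⟨(d/dt)_{γ_1}; …; (d/dt)_{γ_n}⟩_t` READ AS CUMULANTS** — p. 310 display 2 (*"⟨Π_{j∈H}(d/dt)_{γ_j}⟩_t = Σ_{{H′_τ}∈𝒫(H)} Π_τ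
⟨Π_{j∈H′_τ}[;(d/dt)_{γ_j}]⟩_t"*) is the moment–cumulant relation over set partitions, so the truncated functions ARE the Möbius inverse (Ruelle's
Ursell function, the tree's `LatticeModels.ursellOf`) of the slot moments of `BIJ88SlotMoments308`.  With `κ := ursellOf (slot moments)` the display-2
hypothesis `hκ` of p36's gens 9–10 is INHABITED (`LatticeModels.sum_setPartitions_prod_ursellOf`), which makes three statements hypothesis-free:
(i) `Σ_{γ ∈ asg s₀ K} uᵀ_{γ,t}(K) = (d/dt)^{|K|} log z_t` on the branch, for the p. 308 family on ANY finite measure space and in the §5.13 Gaussian model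
(structural hypotheses only); (ii) (5.14.1)–(5.14.2) at the `t = 0` end for centered jointly Gaussian fields, `−log z₁ = 𝒫̃ + ∫₀¹ −((1−t)^{n̄}/n̄!)
Σ_γ uᵀ_{γ,t}(L) dt`, with NO display-2 hypothesis; (iii) in the §5.13 model, modulo the leaf (5.14.4): the cumulants ARE the connected-graph series of
p. 310 display 3 (*"where G_c runs over connected graphs involving all clusters"*) — display 3 as a theorem for the DEFINED truncated functions.

statement-level skeleton of published theorems with citation tags; proofs where landed; nothing here is a claim about the Yang–Mills mass gap

PDF held: `paper:balaban1988-cmp114-bij-abelian-higgs-effective-action` (journal page = PDF page + 256); pp. 308–310 = PDF 52–54 read this session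
(`p0052.txt` L27; `p0054.txt` L9–11 display 2, L14–18 display 3, L25).

WHAT IS REPRODUCED (unit `lit-balaban-p36`, generation 11 of the Phase-2 proof seat p36, file 4; SKELETON rows **C2.Eq5.14.1-5.14.2** ((5.14.1)–(5.14.2),
member), **C2.Claim@310** (displays 2–3, member), **C2.Eq5.14.3-5.14.4** (member) of `HOME/lit-balaban-r16/ROWS-C2-part2.md`; owner r16, heads
untouched; HOME `run/shared/lean/pub/lit-balaban/`).  Theorems only (0 definitions; the cumulant is written `ursellOf (fun K' => slotMoment … t K' γ) K`):
* §1 ABSTRACT (the p. 308 family `z_t = ∫ Π_b χ(c_b p(te_k), Φ_b) e^{−tṼ} dP` of `BIJ88SlotMoments308` on a measure space): `slotMoment_eq_sum_setPartitions_ursell`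
  (display 2 holds for the cumulants — Ruelle), **`sum_asg_ursell_slotMoment_eq_iteratedDeriv_log_zt`** (`Σ_{γ∈asg s₀ K} uᵀ_{γ,t}(K) = (d/dt)^{|K|} log z_t`
  on a set of unique differentiability `s ⊆ (0, e^{−1}/e_k)` where `z > 0`; gen 10's `sum_asg_trunc_eq_iteratedDeriv_log_zt` with `hκ` discharged),
  **`effectiveAction_eq_pertP_add_remR_ursell`** ((5.14.1)–(5.14.2) for centered jointly Gaussian fields: `−log z₁ = 𝒫̃_{k+1} + (n̄+1)·remR(t ↦ Σ_γ
  uᵀ_{γ,t}(L)) = 𝒫̃_{k+1} + ∫₀¹ −((1−t)^{n̄}/n̄!) Σ_γ uᵀ_{γ,t}(L) dt`; gen 10's `effectiveAction_eq_pertP_add_sum_slotTrunc` with `hκ` discharged — no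
  display-2 hypothesis left; the located `(n̄+1)!` slip GAPS G-C2-p36-06).
* §2 THE §5.13 GAUSSIAN MODEL (`fieldLaw blk Δ ℱ W`, slot data `H ↦ zG blk Δ ℱ (fD (uD … t) cube γ H)`):
  **`sum_asg_ursell_slotMoment_fieldLaw_eq_iteratedDeriv_log_zG`** (the same identity, STRUCTURAL hypotheses only — no leaf, no smallness),
  **`ursell_slotMoment_fieldLaw_eq_Tsum_of_ineq5144`** (the cumulants of the slot moments equal p25's connected-graph series `Tsum` of display 3 over
  the virtual supports — gen 10's `trunc_eq_Tsum_of_display2` with `hz`, `hT` discharged from the leaf (5.14.4) by `BIJ88SlotConnectedGraph310KP`).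
HONEST SCOPE: (a) reading: p. 310 display 2 is taken as the DEFINITION of `⟨…;…⟩_t` (gen 9's reading, ROWS-C2-part2 v2.62), here realized by
`ursellOf`; (b) §1 (ii) needs centered jointly Gaussian fields (gen 8), the §5.13 law `fieldLaw` (mean `Δ⁻¹ℱ`) is not threaded to it; (c) (5.14.4) is the
typed leaf, used only in the last theorem; (d) no bound is asserted here (see `BIJ88SlotConnectedGraph310KP`).  0 `sorry`, 0 definitions, 0 new `Prop`
facts (D-0026); imports `BIJ88SlotConnectedGraph310KP` only; modifies nothing.  NOT summit progress; NOT continuum; NOT Clay.  Cell `lit-balaban` Phase 2,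
seat p36 gen 11 (owner r16, referee ref-5).
-/

noncomputable section

namespace Literature.MathematicalPhysics.QuantumFieldTheory.BalabanImbrieJaffe1984to88.BIJ88SlotCumulants308

open Finset MeasureTheory ProbabilityTheory
open Literature.Probability.LatticeModels (setPartitions ursellOf sum_setPartitions_prod_ursellOf)
open Literature.MathematicalPhysics.QuantumFieldTheory.BalabanImbrieJaffe1984to88.BIJ88TruncatedExpectation5142 (asg)
open BIJ88PolymerRep5134 (corner)
open BIJ88PolymerRep5134Gauss (ext prec zG)
open BIJ88Expansion5143 (g3 prime)
open BIJ88Expansion5143Gauss (fD)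
open BIJ88Expansion5143Ordered (polysOf cvsupp locv wv)
open BIJ88ConnectedGraphResummation (Tsum)
open BIJ88SlotMoments308 (zt slotMoment sum_asg_trunc_eq_iteratedDeriv_log_zt effectiveAction_eq_pertP_add_sum_slotTrunc)
open BIJ88SlotMomentsGauss308 (fieldLaw uD slotMoment_fieldLaw_eq sum_asg_trunc_eq_iteratedDeriv_log_zG')
open BIJ88SlotConnectedGraph310 (trunc_eq_Tsum_of_display2)
open BIJ88SlotConnectedGraph310KP (summable_norm_Tord_slot_of_ineq5144 zG_fD_empty_ne_zero_of_ineq5144)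
open BIJ88Ineq5113Covering (cubeSys)
open BIJ88Sect5Statements (CutoffProfile)
open BIJ88Sect5StatementsPart2 (Ineq5144)
open BIJ88Sect5StatementsPart4 (remR pertP)

/-! ## §1 The p. 308 family on a measure space: display 2 holds for the cumulants; `Σ_γ uᵀ = (log z_t)^{(n)}`; the `t = 0` end -/

section Abstract

variable (χ : CutoffProfile) {ι υ Ω : Type*} [MeasurableSpace Ω] [DecidableEq ι] [DecidableEq υ]
  {p ek : ℝ} {B : Finset ι} {Φ : ι → Ω → ℝ} {c : ι → ℝ} {Ys : Finset υ} {V : υ → Ω → ℝ}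

/-- **display 2 of p. 310 HOLDS for the cumulants of the slot moments** (*"The connected components of G define a partition of H which corresponds to
the partition in the formula ⟨Π_{j∈H}(d/dt)_{γ_j}⟩_t = Σ_{{H′_τ}∈𝒫(H)} Π_τ ⟨Π_{j∈H′_τ}[;(d/dt)_{γ_j}]⟩_t"*): with `⟨…;…⟩_t := uᵀ` = the Möbius inverse over set
partitions (`LatticeModels.ursellOf`) of the slot moments `K ↦ ⟨Π_{j∈K}(d/dt)_{γ_j}⟩_t`, the moment–cumulant relation is Ruelle's
`sum_setPartitions_prod_ursellOf` — the hypothesis `hκ` of gens 9–10 is inhabited. [cite: BalabanImbrieJaffe1988, p.310 display 2 (Sect. 5.14)] -/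
theorem slotMoment_eq_sum_setPartitions_ursell (P : Measure Ω) (t : ℝ) {α : Type*} [DecidableEq α] (γ : α → ↥B ⊕ ↥Ys) {K : Finset α}
    (hK : K.Nonempty) :
    slotMoment χ p ek B Φ c Ys V P t K γ =
      ∑ π ∈ setPartitions K, ∏ A ∈ π, ursellOf (fun K' => slotMoment χ p ek B Φ c Ys V P t K' γ) A :=
  (sum_setPartitions_prod_ursellOf (fun K' => slotMoment χ p ek B Φ c Ys V P t K' γ) hK).symm

/-- **`Σ_{γ ∈ asg s₀ K} uᵀ_{γ,t}(K) = (d/dt)^{|K|} log z_t` for the p. 308 family on a finite measure space** (p. 308: *"We express each d/dt as a sum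
Σ_γ (d/dt)_γ … the truncated expectation values ⟨(d/dt)_{γ_1}; … (d/dt)_{γ_{n̄+1}}⟩_t"*): measurable fields, `c_b ≠ 0`, measurable bounded terms,
`e_k > 0`, `t` in a set `s ⊆ (0, e^{−1}/e_k)` of unique differentiability on which `z > 0`; the truncated functions are the CUMULANTS of the slot
moments — gen 10's `BIJ88SlotMoments308.sum_asg_trunc_eq_iteratedDeriv_log_zt` with its display-2 hypothesis `hκ` DISCHARGED.
[cite: BalabanImbrieJaffe1988, (5.14.2) p.308; p.310 display 2] -/
theorem sum_asg_ursell_slotMoment_eq_iteratedDeriv_log_zt (P : Measure Ω) [IsFiniteMeasure P] (hΦ : ∀ b ∈ B, Measurable (Φ b))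
    (hc : ∀ b ∈ B, c b ≠ 0) (hV : ∀ Y ∈ Ys, Measurable (V Y)) {KY : υ → ℝ} (hK : ∀ Y ∈ Ys, ∀ ω, |V Y ω| ≤ KY Y) (hek : 0 < ek)
    {s : Set ℝ} (hs : UniqueDiffOn ℝ s) (hsub : s ⊆ Set.Ioo 0 (Real.exp (-1) / ek)) (hzpos : ∀ x ∈ s, 0 < zt χ p ek B Φ c Ys V P x)
    {α : Type*} [Fintype α] [DecidableEq α] (s₀ : ↥B ⊕ ↥Ys) {t : ℝ} (ht : t ∈ s) {K : Finset α} (hKne : K.Nonempty) :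
    ∑ γ ∈ asg s₀ K, ursellOf (fun K' => slotMoment χ p ek B Φ c Ys V P t K' γ) K =
      iteratedDeriv K.card (fun x => Real.log (zt χ p ek B Φ c Ys V P x)) t :=
  sum_asg_trunc_eq_iteratedDeriv_log_zt χ P hΦ hc hV hK hek hs hsub hzpos s₀ (H := K) ht
    (κ := fun A γ => ursellOf (fun K' => slotMoment χ p ek B Φ c Ys V P t K' γ) A)
    (fun γ _ _ hK' => slotMoment_eq_sum_setPartitions_ursell χ P t γ hK') K Subset.rfl hKne

/-- **(5.14.1)–(5.14.2) AT THE `t = 0` END WITH `⟨…;…⟩_t := THE CUMULANTS, NO DISPLAY-2 HYPOTHESIS** (p. 308: *"𝒫̃_{k+1}(Λ₁₂^{(k)}) = Σ_{α=1}^{n̄} −(1/α!)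
(d^α/dt^α) log z_t(Λ₁₂^{(k)})|_{t=0} … and a remainder ℛ_k(Λ₁₂^{(k)}) = ∫₀¹ dt −((1−t)^{n̄}/(n̄+1)!) ⟨d/dt; …; d/dt⟩_t"*): for the p. 308 family with
χ ≥ 0, `p > 1/2`, centered jointly Gaussian measurable fields, `c_b ≥ c₀ > 0`, measurable bounded terms, `0 < e_k < e^{−1}`, `|L| = n̄+1` labels:
`−log z₁ = 𝒫̃_{k+1} + (n̄+1)·remR(t ↦ Σ_{γ : L → slots} uᵀ_{γ,t}(L))` and `= 𝒫̃_{k+1} + ∫₀¹ −((1−t)^{n̄}/n̄!) Σ_γ uᵀ_{γ,t}(L) dt` — gen 10's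
`effectiveAction_eq_pertP_add_sum_slotTrunc` with `hκ` DISCHARGED (the `(n̄+1)!` of the print is the located slip GAPS G-C2-p36-06).
[cite: BalabanImbrieJaffe1988, (5.14.1)–(5.14.2) p.308; p.310 display 2] -/
theorem effectiveAction_eq_pertP_add_remR_ursell (hχ : ∀ x, 0 ≤ χ.χ₁ x) (hp : 1 / 2 < p) (P : Measure Ω) [IsProbabilityMeasure P]
    (hJ : HasGaussianLaw (fun ω (b : B) => Φ b ω) P) (hΦ : ∀ b ∈ B, Measurable (Φ b)) (h0 : ∀ b ∈ B, P[Φ b] = 0) {c₀ : ℝ}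
    (hc₀ : 0 < c₀) (hcb : ∀ b ∈ B, c₀ ≤ c b) (hV : ∀ Y ∈ Ys, Measurable (V Y)) {KY : υ → ℝ} (hK : ∀ Y ∈ Ys, ∀ ω, |V Y ω| ≤ KY Y)
    (hek : 0 < ek) (hek1 : ek < Real.exp (-1)) {α : Type*} [Fintype α] [DecidableEq α] {nbar : ℕ} (hα : Fintype.card α = nbar + 1)
    (s₀ : ↥B ⊕ ↥Ys) :
    -Real.log (zt χ p ek B Φ c Ys V P 1) = pertP (fun t => Real.log (zt χ p ek B Φ c Ys V P t)) nbar
        + (nbar + 1 : ℝ) * remR (fun t => ∑ γ : α → ↥B ⊕ ↥Ys, ursellOf (fun K' => slotMoment χ p ek B Φ c Ys V P t K' γ) univ) nbar ∧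
      -Real.log (zt χ p ek B Φ c Ys V P 1) = pertP (fun t => Real.log (zt χ p ek B Φ c Ys V P t)) nbar
        + ∫ t in (0 : ℝ)..1, -((1 - t) ^ nbar / nbar.factorial) *
          ∑ γ : α → ↥B ⊕ ↥Ys, ursellOf (fun K' => slotMoment χ p ek B Φ c Ys V P t K' γ) univ :=
  effectiveAction_eq_pertP_add_sum_slotTrunc χ hχ hp P hJ hΦ h0 hc₀ hcb hV hK hek hek1 hα s₀
    (κ := fun t A γ => ursellOf (fun K' => slotMoment χ p ek B Φ c Ys V P t K' γ) A)
    fun t _ γ _ hK => slotMoment_eq_sum_setPartitions_ursell χ P t γ hK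

end Abstract

/-! ## §2 The §5.13 Gaussian model: the identity with structural hypotheses only; the cumulants ARE display 3's connected series modulo (5.14.4) -/

section Model

variable {α I : Type} [Fintype α] [DecidableEq α] [Fintype I] [DecidableEq I]
  (blk : α → I) (Δ : Matrix α α ℝ) (ℱ : α → ℝ) (W : Finset I) (adj : I → I → Prop) [DecidableRel adj] {nbr : I → Finset I} {D : ℕ}
variable (χ : CutoffProfile) {ι υ : Type*} [DecidableEq ι] [DecidableEq υ]
variable {p ek : ℝ} {B : Finset ι} {Φ : ι → (α → ℝ) → ℝ} {c : ι → ℝ} {Ys : Finset υ} {V : υ → (α → ℝ) → ℝ}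
variable (cube : ↥B ⊕ ↥Ys → I) {θ β' : ℝ} {L : Type} [Fintype L] [DecidableEq L]

/-- **`Σ_{γ ∈ asg s₀ K} uᵀ_{γ,t}(K) = (d/dt)^{|K|} log z_t` IN THE §5.13 GAUSSIAN MODEL, STRUCTURAL HYPOTHESES ONLY** (χ(1,·) ≥ 0, `p ≥ 0`, `W`-block of
`Δ` positive definite, cubes of the slots in `W`, continuous fields vanishing at `0`, `c_b ≥ c₀ > 0`, measurable bounded terms, `e_k > 0`, `t` in a set
of unique differentiability `s ⊆ (0, e^{−1}/e_k)`): no leaf, no smallness — the truncated functions being the cumulants of the slot moments of the law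
`fieldLaw blk Δ ℱ W` (gen 10's `sum_asg_trunc_eq_iteratedDeriv_log_zG'`, `hκ` discharged). [cite: BalabanImbrieJaffe1988, (5.14.2) p.308; p.310 display 2] -/
theorem sum_asg_ursell_slotMoment_fieldLaw_eq_iteratedDeriv_log_zG (hχ : ∀ x, 0 ≤ χ.χ₁ x) (hp : 0 ≤ p)
    (hPD : (prec blk Δ W (corner ℝ W)).PosDef) (hcube : ∀ τ, cube τ ∈ W) (hΦc : ∀ b ∈ B, Continuous (Φ b))
    (hΦ0 : ∀ b ∈ B, Φ b 0 = 0) {c₀ : ℝ} (hc₀ : 0 < c₀) (hcb : ∀ b ∈ B, c₀ ≤ c b) (hV : ∀ Y ∈ Ys, Measurable (V Y))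
    {KY : υ → ℝ} (hK : ∀ Y ∈ Ys, ∀ φ, |V Y φ| ≤ KY Y) (hek : 0 < ek) {s : Set ℝ} (hs : UniqueDiffOn ℝ s)
    (hsub : s ⊆ Set.Ioo 0 (Real.exp (-1) / ek)) (s₀ : ↥B ⊕ ↥Ys) (γ₀ : L → ↥B ⊕ ↥Ys) {t : ℝ} (ht : t ∈ s) {K : Finset L} (hKne : K.Nonempty) :
    ∑ γ ∈ asg s₀ K, ursellOf (fun K' => slotMoment χ p ek B (fun b ω => Φ b (ext blk W ω)) c Ys (fun Y ω => V Y (ext blk W ω))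
        (fieldLaw blk Δ ℱ W) t K' γ) K =
      iteratedDeriv K.card (fun x => Real.log (zG blk Δ ℱ (fD (uD χ p ek B Φ c Ys V x) cube γ₀ ∅) W W)) t :=
  sum_asg_trunc_eq_iteratedDeriv_log_zG' blk Δ ℱ W χ cube hχ hp hPD hcube hΦc hΦ0 hc₀ hcb hV hK hek hs hsub s₀ γ₀ (H := K) ht
    (κ := fun A γ => ursellOf (fun K' => slotMoment χ p ek B (fun b ω => Φ b (ext blk W ω)) c Ys (fun Y ω => V Y (ext blk W ω))
      (fieldLaw blk Δ ℱ W) t K' γ) A)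
    (fun γ K' _ hK' => by
      rw [← slotMoment_fieldLaw_eq blk Δ ℱ W χ p ek B Φ c Ys V cube hcube t K' γ]
      exact slotMoment_eq_sum_setPartitions_ursell χ _ t γ hK')
    K Subset.rfl hKne

/-- **THE CUMULANTS ARE THE CONNECTED-GRAPH SERIES OF DISPLAY 3, MODULO (5.14.4)** (p. 310: *"Thus we have a formula ⟨Π_{j∈H}[;(d/dt)_{γ_j}]⟩_t = Σ …
Σ_{G_c} Π_{ℒ∈G_c} a(ℒ) Π_γ g₃(H_γ,X_γ) Π_δ g₃(∅,Y_δ), where G_c runs over connected graphs involving all clusters X_γ, Y_δ, and hence all of H"*): in the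
§5.13 model (`Δ` couples abutting cubes only, cubes of the slots in `W`, cube-local fields and terms), for the slot data of an assignment `γ` whose
prime-dropped activities satisfy the typed leaf (5.14.4) in gen 5's regime (symmetric `adj` of degree `≤ D`, `0 < θ ≤ 1`, `0 ≤ β′`,
`16(D+1)²θ^{β′/2}e² ≤ 1`), the Möbius-inverted slot moments of `fieldLaw` EQUAL p25's connected series `Tsum` over the virtual supports, for every nonempty
block — gen 10's `trunc_eq_Tsum_of_display2` with `hz` and `hT` discharged (`BIJ88SlotConnectedGraph310KP`).
[cite: BalabanImbrieJaffe1988, p.310 displays 2–3; (5.14.4) p.309] -/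
theorem ursell_slotMoment_fieldLaw_eq_Tsum_of_ineq5144 (hR : ∀ x y, adj x y → adj y x) (hD : ∀ x, (nbr x).card ≤ D)
    (hnbr : ∀ x y, adj x y → y ∈ nbr x) (hθ0 : 0 < θ) (hθ1 : θ ≤ 1) (hβ : 0 ≤ β')
    (hsmall : 16 * ((D : ℝ) + 1) ^ 2 * (θ ^ (β' / 2) * Real.exp 2) ≤ 1)
    (hΔ : ∀ x y, blk x ≠ blk y → ¬ adj (blk x) (blk y) → Δ x y = 0) (hcube : ∀ τ, cube τ ∈ W)
    (hΦloc : ∀ b : B, ∀ φ ψ : α → ℝ, (∀ x, blk x = cube (Sum.inl b) → φ x = ψ x) → Φ b φ = Φ b ψ)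
    (hVloc : ∀ Y : Ys, ∀ φ ψ : α → ℝ, (∀ x, blk x = cube (Sum.inr Y) → φ x = ψ x) → V Y φ = V Y ψ) {t : ℝ}
    (γ : L → ↥B ⊕ ↥Ys)
    (h5144 : Ineq5144 (cubeSys I) (Finset L) (prime (g3 adj fun H' => zG blk Δ ℱ (fD (uD χ p ek B Φ c Ys V t) cube γ H')))
      Finset.card (fun H (X : Finset I) => (X \ H.image (cube ∘ γ)).card) θ β') {K : Finset L} (hKne : K.Nonempty) :
    ursellOf (fun K' => slotMoment χ p ek B (fun b ω => Φ b (ext blk W ω)) c Ys (fun Y ω => V Y (ext blk W ω))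
        (fieldLaw blk Δ ℱ W) t K' γ) K =
      Tsum ((polysOf W).image (cvsupp adj W)) (locv (cube ∘ γ))
        (wv (prime (g3 adj fun H' => zG blk Δ ℱ (fD (uD χ p ek B Φ c Ys V t) cube γ H')))) K :=
  trunc_eq_Tsum_of_display2 blk Δ ℱ W adj χ cube hΔ hcube hΦloc hVloc γ
    (zG_fD_empty_ne_zero_of_ineq5144 blk Δ ℱ W adj χ cube hR hD hnbr hθ0 hθ1 hβ hsmall hΔ hΦloc hVloc γ h5144) (H := K)
    (fun b _ hb => summable_norm_Tord_slot_of_ineq5144 blk Δ ℱ W adj χ cube hR hD hnbr hθ0 hθ1 hβ hsmall t γ h5144 b hb)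
    (fun A => ursellOf (fun K' => slotMoment χ p ek B (fun b ω => Φ b (ext blk W ω)) c Ys (fun Y ω => V Y (ext blk W ω))
      (fieldLaw blk Δ ℱ W) t K' γ) A)
    (fun _ _ hK' => slotMoment_eq_sum_setPartitions_ursell χ _ t γ hK') K Subset.rfl hKne

end Model

end Literature.MathematicalPhysics.QuantumFieldTheory.BalabanImbrieJaffe1984to88.BIJ88SlotCumulants308

end
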